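import Literature.NumberTheory.Transcendental.RoyCriterionProp3Proofs
import HarnessLib

/-!
# Roy's criterion — Proposition 2 and Theorem 1 (Roy 2001, §4)

Topic: `Literature/NumberTheory/Transcendental`. Companion of `RoyCriterion.lean`,
`RoyCriterionProofs.lean` and `RoyCriterionProp3Proofs.lean`; it discharges the named facts

* `Roy2001_prop2_holds : Roy2001_prop2` — **Proposition 2** of Roy 2001 (p. 191): for
  `(y, α) ∈ ℂ × ℂˣ` and positive parameters with `max{1, s₀, t₀, s₁ + t₁} < u < ½(1 + t₀ + t₁)`,
  if `α e^{-y}` is a root of unity then condition (b) of Theorem 1 holds for `(y, α)`;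
* `Roy2001_thm1_holds : Roy2001_thm1` — **Theorem 1** of Roy 2001 (p. 184), assembled from
  Propositions 2 and 3 by `Roy2001_thm1_of` (`RoyCriterionProofs.lean`) and `Roy2001_prop3_holds`
  (`RoyCriterionProp3Proofs.lean`).

## The proof of Proposition 2 given here

Roy (p. 191) writes `α = ζ e^y` with `ζ^d = 1`, takes the auxiliary polynomial `P_N` of
Theorem 3 (M. Waldschmidt, Invent. Math. 63 (1981), Thm. 3.1 — vendored only as the named fact
`Roy2001_thm3`) and puts `Q_N = ∏_{k<d} P_N(X₀, ζ^k X₁) ∈ ℤ[X₀, X₁]`, so that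
`g_N(z) = Q_N(z, e^z) = Q_N(z, ζ^m e^z)` is small on `|z| ≤ r` and
`d^k g_N/dz^k (my) = (D^k Q_N)(my, α^m)`; Cauchy's inequalities conclude.

Here the statement proved is Proposition 2 *exactly as printed*, but the polynomial `Q_N` is
produced directly inside `ℤ[X₀, X₁^d]` by the Thue–Siegel construction already used for
`exists_royAuxPoly` (`RoyCriterionProofs.lean`): Siegel's lemma
(`Int.Matrix.exists_ne_zero_int_vec_norm_le`) applied to the first `L = ⌊N^λ⌋ + 1` Taylor
coefficients at `0` of `g(z) = Q(z, e^z) = Σ q_{ab} z^a e^{dbz}` (`a ≤ N^{t₀}`, `db ≤ N^{t₁}`,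
`u < λ < ½(1 + t₀ + t₁)`), followed by the Schwarz-lemma bound
`norm_le_of_iteratedDeriv_eq_zero`. Since `Q ∈ ℤ[X₀, X₁^d]`, `Q(z, η w) = Q(z, w)` whenever
`η^d = 1` (`aeval_polyOfCoeffsD_mul`); this replaces the product over the conjugates `ζ^k` and is
the only place where the hypothesis "`α e^{-y}` is a root of unity" enters, exactly as in print
("`g_N(z) = Q_N(z, ζ^m e^z)` for any `m ∈ ℤ`", p. 191). The rest is Roy's argument verbatim:
`d^k/ds^k Q(my + s, α^m e^s) = (D^k Q)(my + s, α^m e^s)` (`iteratedDeriv_aeval_add_mul_exp`),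
Cauchy's inequality on `|s| = 1`, and `k! ≤ exp(N^u)` for `k ≤ N^{s₀}` because `s₀ < u`
(p. 191: "`N^{s₀} log(N^{s₀}) ≤ N^u`"). The exponent bookkeeping uses only the printed window
`max{1, s₀, t₀, s₁ + t₁} < u < ½(1 + t₀ + t₁)`.

## Sources

* D. Roy, *An arithmetic criterion for the values of the exponential function*, Acta Arith. 97
  (2001), 183–194, DOI 10.4064/aa97-2-6: Prop. 2 (p. 191), Thm. 1 (p. 184), §4 (p. 190).
  [Roy2001]

## Design choices

* No new definitions and no new named facts; all intermediate results are proved here. The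
  `d`-twisted box `X₀^a X₁^{db}` is handled by lemmas about the explicit sum
  `∑ ij, C (t ij) * monoXY ij.1 (d * ij.2)` (parallel to `polyOfCoeffs`, `taylorMatrix` of
  `RoyCriterionProofs.lean`, the case `d = 1`).
-/

noncomputable section

open MvPolynomial Filter Complex Metric Asymptotics Matrix

namespace Literature.NumberTheory.Transcendental

section AuxPolyD

/-! ### Polynomials `Σ t(a,b) X₀^a X₁^{db} ∈ ℤ[X₀, X₁^d]` with prescribed coefficients

No auxiliary definitions are introduced: the exponent vector of `X₀^a X₁^{db}` is written
`Finsupp.single 0 a + Finsupp.single 1 (d b)`, the polynomial with coefficient vector `t` on the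
box `[0, T₀] × [0, T₁]` is `∑ ij, C (t ij) * monoXY ij.1 (d ij.2)`, and the matrix of the Taylor
equations is `Matrix.of fun n ij => taylorInt n (monoXY ij.1 (d ij.2))` (compare `boxExp`,
`polyOfCoeffs`, `taylorMatrix` of `RoyCriterionProofs.lean`, the case `d = 1`). -/

/-- The `X₀`-exponent of the exponent vector `(a, b)` of `X₀^a X₁^b`. [folklore] -/
@[simp] theorem boxExpD_zero (a b : ℕ) :
    ((Finsupp.single (0 : Fin 2) a + Finsupp.single 1 b : Fin 2 →₀ ℕ)) 0 = a := by
  simp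

/-- The `X₁`-exponent of the exponent vector `(a, b)` of `X₀^a X₁^b`. [folklore] -/
@[simp] theorem boxExpD_one (a b : ℕ) :
    ((Finsupp.single (0 : Fin 2) a + Finsupp.single 1 b : Fin 2 →₀ ℕ)) 1 = b := by
  simp

/-- `(a, b) ↦ (a, db)` is injective on the box for `d ≠ 0`. [folklore] -/
theorem boxExpD_eq_iff {d : ℕ} (hd : d ≠ 0) {T₀ T₁ : ℕ} (x y : Fin (T₀ + 1) × Fin (T₁ + 1)) :
    Finsupp.single (0 : Fin 2) (x.1 : ℕ) + Finsupp.single 1 (d * (x.2 : ℕ)) =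
      Finsupp.single (0 : Fin 2) (y.1 : ℕ) + Finsupp.single 1 (d * (y.2 : ℕ)) ↔ x = y := by
  refine ⟨fun h => ?_, fun h => by rw [h]⟩
  have h0 := congrArg (fun m => m 0) h
  have h1 := congrArg (fun m => m 1) h
  simp only [boxExpD_zero, boxExpD_one] at h0 h1
  exact Prod.ext (Fin.ext h0) (Fin.ext (Nat.eq_of_mul_eq_mul_left (Nat.pos_of_ne_zero hd) h1))

/-- `C c · X₀^a X₁^{db}` is the monomial with exponent `(a, db)` and coefficient `c`.
[folklore] -/
theorem C_mul_monoXY_eq_monomialD (d : ℕ) {T₀ T₁ : ℕ} (c : ℤ)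
    (ij : Fin (T₀ + 1) × Fin (T₁ + 1)) :
    C c * monoXY ij.1 (d * ij.2) =
      monomial (Finsupp.single (0 : Fin 2) (ij.1 : ℕ) + Finsupp.single 1 (d * (ij.2 : ℕ))) c := by
  simp only [monoXY, X_pow_eq_monomial, monomial_mul, C_apply, mul_one, zero_add]

/-- `Σ t(a,b) X₀^a X₁^{db}` as a sum of monomials. [folklore] -/
theorem polyOfCoeffsD_eq_sum_monomial (d : ℕ) {T₀ T₁ : ℕ}
    (t : Fin (T₀ + 1) × Fin (T₁ + 1) → ℤ) :
    (∑ ij, C (t ij) * monoXY ij.1 (d * ij.2) : MvPolynomial (Fin 2) ℤ) =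
      ∑ ij, monomial (Finsupp.single (0 : Fin 2) (ij.1 : ℕ) + Finsupp.single 1 (d * (ij.2 : ℕ)))
        (t ij) := by
  simp only [C_mul_monoXY_eq_monomialD]

/-- The coefficients of `Σ t(a,b) X₀^a X₁^{db}` inside the box are the `t(a,b)`. [folklore] -/
theorem coeff_polyOfCoeffsD {d : ℕ} (hd : d ≠ 0) {T₀ T₁ : ℕ}
    (t : Fin (T₀ + 1) × Fin (T₁ + 1) → ℤ) (ab : Fin (T₀ + 1) × Fin (T₁ + 1)) :
    coeff (Finsupp.single (0 : Fin 2) (ab.1 : ℕ) + Finsupp.single 1 (d * (ab.2 : ℕ)))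
      (∑ ij, C (t ij) * monoXY ij.1 (d * ij.2)) = t ab := by
  rw [polyOfCoeffsD_eq_sum_monomial, coeff_sum, Finset.sum_eq_single ab]
  · simp
  · intro b _ hb
    simp [coeff_monomial, boxExpD_eq_iff hd, hb]
  · intro h; exact absurd (Finset.mem_univ ab) h

/-- Outside the box the coefficients of `Σ t(a,b) X₀^a X₁^{db}` vanish. [folklore] -/
theorem coeff_polyOfCoeffsD_eq_zero (d : ℕ) {T₀ T₁ : ℕ} (t : Fin (T₀ + 1) × Fin (T₁ + 1) → ℤ)
    (m : Fin 2 →₀ ℕ) (hm : ∀ ij : Fin (T₀ + 1) × Fin (T₁ + 1),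
      Finsupp.single (0 : Fin 2) (ij.1 : ℕ) + Finsupp.single 1 (d * (ij.2 : ℕ)) ≠ m) :
    coeff m (∑ ij, C (t ij) * monoXY ij.1 (d * ij.2)) = 0 := by
  rw [polyOfCoeffsD_eq_sum_monomial, coeff_sum]
  exact Finset.sum_eq_zero fun ij _ => by rw [coeff_monomial, if_neg (hm ij)]

/-- Every coefficient of `Σ t(a,b) X₀^a X₁^{db}` is bounded by `‖t‖`. [folklore] -/
theorem natAbs_coeff_polyOfCoeffsD_le {d : ℕ} (hd : d ≠ 0) {T₀ T₁ : ℕ}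
    (t : Fin (T₀ + 1) × Fin (T₁ + 1) → ℤ) (m : Fin 2 →₀ ℕ) :
    ((coeff m (∑ ij, C (t ij) * monoXY ij.1 (d * ij.2))).natAbs : ℝ) ≤ ‖t‖ := by
  by_cases h : ∃ ab : Fin (T₀ + 1) × Fin (T₁ + 1),
    Finsupp.single (0 : Fin 2) (ab.1 : ℕ) + Finsupp.single 1 (d * (ab.2 : ℕ)) = m
  · obtain ⟨ab, rfl⟩ := h
    rw [coeff_polyOfCoeffsD hd]
    have := norm_le_pi_norm t ab
    rw [Int.norm_eq_abs] at this
    rw [Nat.cast_natAbs]; exact_mod_cast this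
  · rw [not_exists] at h
    rw [coeff_polyOfCoeffsD_eq_zero d t m h]
    simp

/-- The height of `Σ t(a,b) X₀^a X₁^{db}` is at most `‖t‖`. [folklore] -/
theorem mvPolyHeight_polyOfCoeffsD_le {d : ℕ} (hd : d ≠ 0) {T₀ T₁ : ℕ}
    (t : Fin (T₀ + 1) × Fin (T₁ + 1) → ℤ) :
    (mvPolyHeight (∑ ij, C (t ij) * monoXY ij.1 (d * ij.2)) : ℝ) ≤ ‖t‖ := by
  have h : mvPolyHeight (∑ ij, C (t ij) * monoXY ij.1 (d * ij.2)) ≤ ⌊‖t‖⌋₊ := by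
    refine Finset.sup_le fun m _ => Nat.le_floor ?_
    exact natAbs_coeff_polyOfCoeffsD_le hd t m
  calc (mvPolyHeight (∑ ij, C (t ij) * monoXY ij.1 (d * ij.2)) : ℝ) ≤ ⌊‖t‖⌋₊ := by
        exact_mod_cast h
    _ ≤ ‖t‖ := Nat.floor_le (norm_nonneg _)

/-- `Σ t(a,b) X₀^a X₁^{db} ≠ 0` for `t ≠ 0` and `d ≠ 0`. [folklore] -/
theorem polyOfCoeffsD_ne_zero {d : ℕ} (hd : d ≠ 0) {T₀ T₁ : ℕ}
    {t : Fin (T₀ + 1) × Fin (T₁ + 1) → ℤ} (ht : t ≠ 0) :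
    (∑ ij, C (t ij) * monoXY ij.1 (d * ij.2) : MvPolynomial (Fin 2) ℤ) ≠ 0 := by
  obtain ⟨ab, hab⟩ := Function.ne_iff.1 ht
  intro h
  have := coeff_polyOfCoeffsD hd t ab
  rw [h, coeff_zero] at this
  exact hab this.symm

/-- Partial degrees of `Σ t(a,b) X₀^a X₁^{db}`: `deg_{X₀} ≤ T₀`. [folklore] -/
theorem degreeOf_polyOfCoeffsD_fst (d : ℕ) {T₀ T₁ : ℕ} (t : Fin (T₀ + 1) × Fin (T₁ + 1) → ℤ) :
    (∑ ij, C (t ij) * monoXY ij.1 (d * ij.2) : MvPolynomial (Fin 2) ℤ).degreeOf 0 ≤ T₀ := by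
  rw [degreeOf_le_iff]
  intro m hm
  rw [mem_support_iff] at hm
  by_contra hlt
  refine hm (coeff_polyOfCoeffsD_eq_zero d t m fun ab h => ?_)
  have := congrArg (fun m => m 0) h
  simp only [boxExpD_zero] at this
  have hab : (ab.1 : ℕ) ≤ T₀ := Nat.lt_succ_iff.1 ab.1.isLt
  omega

/-- Partial degrees of `Σ t(a,b) X₀^a X₁^{db}`: `deg_{X₁} ≤ d T₁`. [folklore] -/
theorem degreeOf_polyOfCoeffsD_snd (d : ℕ) {T₀ T₁ : ℕ} (t : Fin (T₀ + 1) × Fin (T₁ + 1) → ℤ) :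
    (∑ ij, C (t ij) * monoXY ij.1 (d * ij.2) : MvPolynomial (Fin 2) ℤ).degreeOf 1 ≤ d * T₁ := by
  rw [degreeOf_le_iff]
  intro m hm
  rw [mem_support_iff] at hm
  by_contra hlt
  refine hm (coeff_polyOfCoeffsD_eq_zero d t m fun ab h => ?_)
  have := congrArg (fun m => m 1) h
  simp only [boxExpD_one] at this
  have hab : (ab.2 : ℕ) ≤ T₁ := Nat.lt_succ_iff.1 ab.2.isLt
  have hmul : d * (ab.2 : ℕ) ≤ d * T₁ := Nat.mul_le_mul_left d hab
  omega

/-- Evaluation: `(Σ t(a,b) X₀^a X₁^{db})(z, w) = Σ t(a,b) z^a w^{db}`. [folklore] -/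
theorem aeval_polyOfCoeffsD (d : ℕ) {T₀ T₁ : ℕ} (t : Fin (T₀ + 1) × Fin (T₁ + 1) → ℤ)
    (z w : ℂ) :
    aeval ![z, w] (∑ ij, C (t ij) * monoXY ij.1 (d * ij.2) : MvPolynomial (Fin 2) ℤ) =
      ∑ ij, (t ij : ℂ) * (z ^ (ij.1 : ℕ) * w ^ (d * (ij.2 : ℕ))) := by
  simp [monoXY, map_sum, map_mul, map_pow]

/-- The twist by a `d`-th root of unity in `X₁` does not change `Q ∈ ℤ[X₀, X₁^d]`:
`Q(z, η w) = Q(z, w)` for `η^d = 1` (this is how "`g_N(z) = Q_N(z, ζ^m e^z)` for any `m`",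
Roy 2001, p. 191, is realised here). [cite: Roy2001, Prop. 2 (proof)] -/
theorem aeval_polyOfCoeffsD_mul {d : ℕ} {T₀ T₁ : ℕ} (t : Fin (T₀ + 1) × Fin (T₁ + 1) → ℤ)
    (z w η : ℂ) (hη : η ^ d = 1) :
    aeval ![z, η * w] (∑ ij, C (t ij) * monoXY ij.1 (d * ij.2) : MvPolynomial (Fin 2) ℤ) =
      aeval ![z, w] (∑ ij, C (t ij) * monoXY ij.1 (d * ij.2) : MvPolynomial (Fin 2) ℤ) := by
  simp only [aeval_polyOfCoeffsD, mul_pow, pow_mul, hη, one_mul]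

/-! ### The Taylor-coefficient equations -/

/-- `taylorInt n` on `Σ t(a,b) X₀^a X₁^{db}` is the linear form
`Σ t(a,b) · taylorInt n (X₀^a X₁^{db})`. [folklore] -/
theorem taylorInt_polyOfCoeffsD (d : ℕ) {T₀ T₁ : ℕ} (n : ℕ)
    (t : Fin (T₀ + 1) × Fin (T₁ + 1) → ℤ) :
    taylorInt n (∑ ij, C (t ij) * monoXY ij.1 (d * ij.2)) =
      ∑ ij, taylorInt n (monoXY ij.1 (d * ij.2)) * t ij := by
  simp only [taylorInt, iterate_royD_sum, iterate_royD_C_mul, map_sum, map_mul, eval_C]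
  exact Finset.sum_congr rfl fun ij _ => mul_comm _ _

/-- With `A = (taylorInt n (X₀^a X₁^{db}))_{n, (a,b)}`: `(A t)_n = taylorInt n (Σ t(a,b) X₀^a
X₁^{db})`, i.e. the Taylor equations are `A t = 0`. [folklore] -/
theorem taylorMatrixD_mulVec {d L T₀ T₁ : ℕ} (t : Fin (T₀ + 1) × Fin (T₁ + 1) → ℤ) (n : Fin L) :
    ((Matrix.of fun (n : Fin L) (ij : Fin (T₀ + 1) × Fin (T₁ + 1)) =>
        taylorInt n (monoXY ij.1 (d * ij.2))) *ᵥ t) n =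
      taylorInt n (∑ ij, C (t ij) * monoXY ij.1 (d * ij.2)) := by
  rw [taylorInt_polyOfCoeffsD]
  simp [Matrix.mulVec, dotProduct]

/-- Entry bound for the Taylor matrix `A = (taylorInt n (X₀^a X₁^{db}))`: `|A_{n,(a,b)}| ≤ L^L e^{d T₁}`
(for `L ≥ 1`), whence `‖A‖ ≤ L^L e^{d T₁}` for the entrywise sup norm. [folklore] -/
theorem norm_taylorMatrixD_entry_le (d L T₀ T₁ : ℕ) (hL : 1 ≤ L) (n : Fin L)
    (ij : Fin (T₀ + 1) × Fin (T₁ + 1)) :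
    ‖(Matrix.of fun (n : Fin L) (ij : Fin (T₀ + 1) × Fin (T₁ + 1)) =>
        taylorInt n (monoXY ij.1 (d * ij.2))) n ij‖ ≤ (L : ℝ) ^ L * Real.exp ((d : ℝ) * T₁) := by
  obtain ⟨a, b⟩ := ij
  rw [Matrix.of_apply, Int.norm_eq_abs]
  have hb : ((b : ℕ) : ℝ) ≤ T₁ := by exact_mod_cast Nat.lt_succ_iff.1 b.isLt
  have hdb : ((d * (b : ℕ) : ℕ) : ℝ) ≤ (d : ℝ) * T₁ := by
    push_cast
    exact mul_le_mul_of_nonneg_left hb (Nat.cast_nonneg d)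
  have hn : (n : ℕ) ≤ L := n.isLt.le
  have hfact : ((n : ℕ).factorial : ℝ) ≤ (L : ℝ) ^ L := by
    calc ((n : ℕ).factorial : ℝ) ≤ ((n : ℕ) : ℝ) ^ (n : ℕ) := by
          exact_mod_cast Nat.factorial_le_pow n
      _ ≤ (L : ℝ) ^ (n : ℕ) := by gcongr
      _ ≤ (L : ℝ) ^ L := pow_le_pow_right₀ (by exact_mod_cast hL) hn
  calc (|taylorInt n (monoXY a (d * b))| : ℝ)
      ≤ (n : ℕ).factorial * Real.exp ((d * (b : ℕ) : ℕ) : ℝ) := abs_taylorInt_monoXY_le n a (d * b)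
    _ ≤ (L : ℝ) ^ L * Real.exp ((d : ℝ) * T₁) := by gcongr


/-! ### Parameter bookkeeping under the window of Proposition 2

The three numerical facts behind `exists_royAuxPolyD`, for `max{1, t₀, s₁ + t₁} < u <
½(1 + t₀ + t₁)`, `d ≥ 1`, `c ≥ 0` and large real `x` (later `x = N`), with `T₀ = ⌊x^{t₀}⌋`,
`T₁ = ⌊x^{t₁}⌋`, `T₁' = ⌊x^{t₁}/d⌋`, `L = ⌊x^λ⌋ + 1` (`λ = royLambda t₀ t₁ u`),
`M' = (T₀+1)(T₁'+1)`, `M = (T₀+1)(T₁+1)`, `R = 2(1 + cx^{s₁})`. -/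

/-- Counting: `2L ≤ M' = (T₀+1)(T₁'+1)` (more unknowns than twice the equations), since
`λ < t₀ + t₁`. [folklore] -/
theorem eventually_aux_paramsD_count {t₀ t₁ u : ℝ} (h1u : 1 < u) (h3 : u < (1 + t₀ + t₁) / 2)
    {d : ℕ} (hd : 1 ≤ d) :
    ∀ᶠ x : ℝ in atTop,
      2 * ((⌊x ^ royLambda t₀ t₁ u⌋₊ + 1 : ℕ) : ℝ) ≤
        (((⌊x ^ t₀⌋₊ + 1) * (⌊x ^ t₁ / d⌋₊ + 1) : ℕ) : ℝ) := by
  have htt : 1 < t₀ + t₁ := by linarith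
  set lam : ℝ := royLambda t₀ t₁ u with hlam
  have hlam2 : 2 * lam < 1 + t₀ + t₁ := by rw [hlam, royLambda]; linarith
  have hlamtt : lam < t₀ + t₁ := by linarith
  have hd0 : (0 : ℝ) < d := by exact_mod_cast hd
  filter_upwards [eventually_ge_atTop (1 : ℝ),
    eventually_mul_rpow_le_mul_rpow (4 * (d : ℝ)) hlamtt one_pos,
    eventually_const_le_mul_rpow (4 * (d : ℝ)) (zero_lt_one.trans htt) one_pos]
    with x hx1 Ea1 Ea2
  have hx0 : 0 < x := one_pos.trans_le hx1
  have hxpos : ∀ s : ℝ, 0 < x ^ s := fun s => Real.rpow_pos_of_pos hx0 s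
  have hq0 : 0 < x ^ t₁ / d := div_pos (hxpos t₁) hd0
  have hT₀' : x ^ t₀ < (⌊x ^ t₀⌋₊ : ℝ) + 1 := Nat.lt_floor_add_one _
  have hT₁'gt : x ^ t₁ / d < (⌊x ^ t₁ / d⌋₊ : ℝ) + 1 := Nat.lt_floor_add_one _
  have hLle : ((⌊x ^ lam⌋₊ + 1 : ℕ) : ℝ) ≤ x ^ lam + 1 := by
    push_cast; linarith only [Nat.floor_le (hxpos lam).le]
  have hPx : x ^ t₀ * (x ^ t₁ / d) * d = x ^ (t₀ + t₁) := by
    rw [Real.rpow_add hx0, mul_assoc, div_mul_cancel₀ _ hd0.ne']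
  have hM'gt : x ^ t₀ * (x ^ t₁ / d) < (((⌊x ^ t₀⌋₊ + 1) * (⌊x ^ t₁ / d⌋₊ + 1) : ℕ) : ℝ) := by
    push_cast
    exact mul_lt_mul'' hT₀' hT₁'gt (hxpos _).le hq0.le
  have ha' : 2 * x ^ lam + 2 ≤ x ^ t₀ * (x ^ t₁ / d) := by
    refine le_of_mul_le_mul_right ?_ hd0
    rw [hPx]
    linarith only [Ea1, Ea2]
  linarith only [hLle, ha', hM'gt]

/-- Siegel exponent: `L/(M' - L) · (log M' + L log L + T₁) ≤ x`, since `2λ - t₀ - t₁ < 1` and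
`λ - t₀ < 1` (the latter because `t₁ < 1 + t₀`, from `s₁ + t₁ < u < ½(1 + t₀ + t₁)`). [folklore] -/
theorem eventually_aux_paramsD_siegel {s₁ t₀ t₁ u : ℝ} (hs₁ : 0 < s₁) (ht₀ : 0 < t₀) (ht₁ : 0 < t₁)
    (h1u : 1 < u) (hst : s₁ + t₁ < u) (h3 : u < (1 + t₀ + t₁) / 2) {d : ℕ} (hd : 1 ≤ d) :
    ∀ᶠ x : ℝ in atTop,
      ((⌊x ^ royLambda t₀ t₁ u⌋₊ + 1 : ℕ) : ℝ) /
          ((((⌊x ^ t₀⌋₊ + 1) * (⌊x ^ t₁ / d⌋₊ + 1) : ℕ) : ℝ) -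
            ((⌊x ^ royLambda t₀ t₁ u⌋₊ + 1 : ℕ) : ℝ)) *
        (Real.log (((⌊x ^ t₀⌋₊ + 1) * (⌊x ^ t₁ / d⌋₊ + 1) : ℕ) : ℝ) +
          ((⌊x ^ royLambda t₀ t₁ u⌋₊ + 1 : ℕ) : ℝ) *
            Real.log ((⌊x ^ royLambda t₀ t₁ u⌋₊ + 1 : ℕ) : ℝ) +
          (⌊x ^ t₁⌋₊ : ℝ)) ≤ x := by
  have hA := eventually_aux_paramsD_count h1u h3 hd
  have htt : 1 < t₀ + t₁ := by linarith
  have ht₁t₀ : t₁ < 1 + t₀ := by linarith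
  set lam : ℝ := royLambda t₀ t₁ u with hlam
  have hulam : u < lam := by rw [hlam, royLambda]; linarith
  have hlam2 : 2 * lam < 1 + t₀ + t₁ := by rw [hlam, royLambda]; linarith
  have hlamt₀ : lam - t₀ < 1 := by linarith
  have hlam0 : 0 < lam := by linarith
  have hμ : 2 * lam - t₀ - t₁ < 1 := by linarith
  have hneg : lam - t₀ - t₁ < 1 := by linarith
  have hd0 : (0 : ℝ) < d := by exact_mod_cast hd
  have hd1 : (1 : ℝ) ≤ d := by exact_mod_cast hd
  have q5 : (0 : ℝ) < 1 / 5 := by norm_num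
  have hC2 : (0 : ℝ) ≤ 4 * d * (t₀ + t₁) := by positivity
  have hC4 : (0 : ℝ) ≤ 8 * d * lam := by positivity
  filter_upwards [eventually_ge_atTop (1 : ℝ), hA,
    eventually_mul_rpow_le_mul_rpow (4 * d * Real.log 4) hneg q5,
    eventually_mul_rpow_mul_log_le hneg hC2 q5,
    eventually_mul_rpow_le_mul_rpow (8 * d * Real.log 2) hμ q5,
    eventually_mul_rpow_mul_log_le hμ hC4 q5,
    eventually_mul_rpow_le_mul_rpow (4 * (d : ℝ)) hlamt₀ q5]
    with x hx1 ha Eb1 Eb2 Eb3 Eb4 Eb5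
  have hx0 : 0 < x := one_pos.trans_le hx1
  have hxpos : ∀ s : ℝ, 0 < x ^ s := fun s => Real.rpow_pos_of_pos hx0 s
  have hx1t : ∀ {s : ℝ}, 0 ≤ s → 1 ≤ x ^ s := fun hs => Real.one_le_rpow hx1 hs
  -- the integers
  set T₀ : ℕ := ⌊x ^ t₀⌋₊ with hT₀def
  set T₁ : ℕ := ⌊x ^ t₁⌋₊ with hT₁def
  set T₁' : ℕ := ⌊x ^ t₁ / d⌋₊ with hT₁'def
  set L : ℕ := ⌊x ^ lam⌋₊ + 1 with hLdef
  have hq0 : 0 < x ^ t₁ / d := div_pos (hxpos t₁) hd0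
  have hqle : x ^ t₁ / d ≤ x ^ t₁ := div_le_self (hxpos t₁).le hd1
  have hT₀ : (T₀ : ℝ) ≤ x ^ t₀ := Nat.floor_le (hxpos t₀).le
  have hT₁ : (T₁ : ℝ) ≤ x ^ t₁ := Nat.floor_le (hxpos t₁).le
  have hT₁' : (T₁' : ℝ) ≤ x ^ t₁ / d := Nat.floor_le hq0.le
  have hT₀' : x ^ t₀ < T₀ + 1 := Nat.lt_floor_add_one _
  have hT₁'gt : x ^ t₁ / d < T₁' + 1 := Nat.lt_floor_add_one _
  have hLle : (L : ℝ) ≤ x ^ lam + 1 := by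
    rw [hLdef]; push_cast; linarith only [Nat.floor_le (hxpos lam).le]
  have hL2 : (L : ℝ) ≤ 2 * x ^ lam := by linarith only [hLle, hx1t hlam0.le]
  have hL1 : (1 : ℝ) ≤ L := by
    rw [hLdef]; push_cast; linarith only [(Nat.cast_nonneg _ : (0 : ℝ) ≤ ⌊x ^ lam⌋₊)]
  have hM'def : (((T₀ + 1) * (T₁' + 1) : ℕ) : ℝ) = ((T₀ : ℝ) + 1) * ((T₁' : ℝ) + 1) := by
    push_cast; ring
  set M' : ℝ := (((T₀ + 1) * (T₁' + 1) : ℕ) : ℝ) with hM'set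
  have hPx : x ^ t₀ * (x ^ t₁ / d) * d = x ^ (t₀ + t₁) := by
    rw [Real.rpow_add hx0, mul_assoc, div_mul_cancel₀ _ hd0.ne']
  have hPpos : 0 < x ^ t₀ * (x ^ t₁ / d) := mul_pos (hxpos _) hq0
  have hM'gt : x ^ t₀ * (x ^ t₁ / d) < M' := by
    rw [hM'def]; exact mul_lt_mul'' hT₀' hT₁'gt (hxpos _).le hq0.le
  have hM'le : M' ≤ 4 * x ^ (t₀ + t₁) := by
    rw [hM'def, Real.rpow_add hx0]
    have h0 : (T₀ : ℝ) + 1 ≤ 2 * x ^ t₀ := by linarith only [hT₀, hx1t ht₀.le]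
    have h1 : (T₁' : ℝ) + 1 ≤ 2 * x ^ t₁ := by linarith only [hT₁', hqle, hx1t ht₁.le]
    calc ((T₀ : ℝ) + 1) * ((T₁' : ℝ) + 1) ≤ (2 * x ^ t₀) * (2 * x ^ t₁) := by gcongr
      _ = 4 * (x ^ t₀ * x ^ t₁) := by ring
  have hM'pos : 0 < M' := hPpos.trans hM'gt
  have hM'1 : 1 ≤ M' := by linarith only [ha, hL1]
  -- exponent algebra
  have hA' : x ^ (lam - t₀ - t₁) * x ^ lam = x ^ (2 * lam - t₀ - t₁) := by
    rw [← Real.rpow_add hx0]; ring_nf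
  have hB : x ^ (lam - t₀ - t₁) * x ^ t₁ = x ^ (lam - t₀) := by
    rw [← Real.rpow_add hx0]; ring_nf
  have hC : x ^ (lam - t₀ - t₁) * x ^ (t₀ + t₁) = x ^ lam := by
    rw [← Real.rpow_add hx0]; ring_nf
  have he : (L : ℝ) / (M' - L) ≤ 4 * d * x ^ (lam - t₀ - t₁) := by
    have hML : M' / 2 ≤ M' - L := by linarith only [ha]
    calc (L : ℝ) / (M' - L) ≤ L / (M' / 2) :=
          div_le_div_of_nonneg_left (Nat.cast_nonneg _) (half_pos hM'pos) hML
      _ = 2 * L / M' := by rw [div_div_eq_mul_div]; ring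
      _ ≤ 2 * (2 * x ^ lam) / (x ^ t₀ * (x ^ t₁ / d)) :=
          div_le_div₀ (by positivity) (by linarith only [hL2]) hPpos hM'gt.le
      _ = 4 * d * x ^ (lam - t₀ - t₁) := by
          rw [div_eq_iff hPpos.ne']
          calc 2 * (2 * x ^ lam) = 4 * (x ^ (lam - t₀ - t₁) * x ^ (t₀ + t₁)) := by rw [hC]; ring
            _ = 4 * (x ^ (lam - t₀ - t₁) * (x ^ t₀ * (x ^ t₁ / d) * d)) := by rw [hPx]
            _ = 4 * d * x ^ (lam - t₀ - t₁) * (x ^ t₀ * (x ^ t₁ / d)) := by ring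
  have hS : Real.log M' + L * Real.log L + T₁ ≤
      Real.log 4 + (t₀ + t₁) * Real.log x + 2 * x ^ lam * (Real.log 2 + lam * Real.log x) +
        x ^ t₁ := by
    have h1 : Real.log M' ≤ Real.log 4 + (t₀ + t₁) * Real.log x := by
      calc Real.log M' ≤ Real.log (4 * x ^ (t₀ + t₁)) := Real.log_le_log hM'pos hM'le
        _ = Real.log 4 + (t₀ + t₁) * Real.log x := by
            rw [Real.log_mul (by norm_num) (hxpos _).ne', Real.log_rpow hx0]
    have h2 : (L : ℝ) * Real.log L ≤ 2 * x ^ lam * (Real.log 2 + lam * Real.log x) := by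
      have hlogL : Real.log L ≤ Real.log 2 + lam * Real.log x := by
        calc Real.log L ≤ Real.log (2 * x ^ lam) :=
              Real.log_le_log (by linarith only [hL1]) hL2
          _ = Real.log 2 + lam * Real.log x := by
              rw [Real.log_mul (by norm_num) (hxpos _).ne', Real.log_rpow hx0]
      have hlogL0 : 0 ≤ Real.log L := Real.log_nonneg hL1
      exact mul_le_mul hL2 hlogL hlogL0 (by positivity)
    linarith only [h1, h2, hT₁]
  have hS0 : 0 ≤ Real.log M' + L * Real.log L + T₁ := by
    have h1 : 0 ≤ Real.log M' := Real.log_nonneg hM'1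
    have h2 : 0 ≤ (L : ℝ) * Real.log L := mul_nonneg (Nat.cast_nonneg _) (Real.log_nonneg hL1)
    have h3 : (0 : ℝ) ≤ T₁ := Nat.cast_nonneg _
    linarith only [h1, h2, h3]
  calc (L : ℝ) / (M' - L) * (Real.log M' + L * Real.log L + T₁)
      ≤ (4 * d * x ^ (lam - t₀ - t₁)) * (Real.log 4 + (t₀ + t₁) * Real.log x +
          2 * x ^ lam * (Real.log 2 + lam * Real.log x) + x ^ t₁) :=
        mul_le_mul he hS hS0 (by positivity)
    _ = 4 * d * Real.log 4 * x ^ (lam - t₀ - t₁) +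
          4 * d * (t₀ + t₁) * x ^ (lam - t₀ - t₁) * Real.log x +
          8 * d * Real.log 2 * (x ^ (lam - t₀ - t₁) * x ^ lam) +
          8 * d * lam * (x ^ (lam - t₀ - t₁) * x ^ lam) * Real.log x +
          4 * d * (x ^ (lam - t₀ - t₁) * x ^ t₁) := by ring
    _ ≤ x := by
        rw [hA', hB]
        have hx : x ^ (1 : ℝ) = x := Real.rpow_one x
        rw [hx] at Eb1 Eb2 Eb3 Eb4 Eb5
        linarith only [Eb1, Eb2, Eb3, Eb4, Eb5]

/-- Smallness: `log 2 - L log 2 + log M + x + T₀ log R + T₁ R ≤ -2x^u`, since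
`λ > u > max{1, t₀, s₁ + t₁}`. [folklore] -/
theorem eventually_aux_paramsD_small {s₁ t₀ t₁ u : ℝ} (hs₁ : 0 < s₁) (ht₀ : 0 < t₀) (ht₁ : 0 < t₁)
    (h1u : 1 < u) (ht₀u : t₀ < u) (hst : s₁ + t₁ < u) (h3 : u < (1 + t₀ + t₁) / 2)
    {c : ℝ} (hc : 0 ≤ c) :
    ∀ᶠ x : ℝ in atTop,
      Real.log 2 - ((⌊x ^ royLambda t₀ t₁ u⌋₊ + 1 : ℕ) : ℝ) * Real.log 2 +
          Real.log (((⌊x ^ t₀⌋₊ + 1) * (⌊x ^ t₁⌋₊ + 1) : ℕ) : ℝ) + x +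
          (⌊x ^ t₀⌋₊ : ℝ) * Real.log (2 * (1 + c * x ^ s₁)) +
          (⌊x ^ t₁⌋₊ : ℝ) * (2 * (1 + c * x ^ s₁)) ≤ -(2 * x ^ u) := by
  set lam : ℝ := royLambda t₀ t₁ u with hlam
  have hulam : u < lam := by rw [hlam, royLambda]; linarith
  have hlam0 : 0 < lam := by linarith
  have hl2 : 0 < Real.log 2 := Real.log_pos one_lt_two
  have q8 : (0 : ℝ) < Real.log 2 / 8 := by positivity
  filter_upwards [eventually_ge_atTop (1 : ℝ),
    eventually_const_le_mul_rpow (Real.log 2 + Real.log 4) hlam0 q8,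
    eventually_mul_rpow_mul_log_le hlam0 (show (0 : ℝ) ≤ t₀ + t₁ by linarith) q8,
    eventually_mul_rpow_le_mul_rpow 1 (h1u.trans hulam) q8,
    eventually_mul_rpow_le_mul_rpow (Real.log (2 + 2 * c)) (ht₀u.trans hulam) q8,
    eventually_mul_rpow_mul_log_le (ht₀u.trans hulam) hs₁.le q8,
    eventually_mul_rpow_le_mul_rpow (2 + 2 * c) (hst.trans hulam) q8,
    eventually_mul_rpow_le_mul_rpow 2 hulam q8]
    with x hx1 Ec1 Ec2 Ec3 Ec4 Ec5 Ec6 Ec7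
  have hx0 : 0 < x := one_pos.trans_le hx1
  have hxpos : ∀ s : ℝ, 0 < x ^ s := fun s => Real.rpow_pos_of_pos hx0 s
  have hx1t : ∀ {s : ℝ}, 0 ≤ s → 1 ≤ x ^ s := fun hs => Real.one_le_rpow hx1 hs
  -- the integers
  set T₀ : ℕ := ⌊x ^ t₀⌋₊ with hT₀def
  set T₁ : ℕ := ⌊x ^ t₁⌋₊ with hT₁def
  set L : ℕ := ⌊x ^ lam⌋₊ + 1 with hLdef
  have hT₀ : (T₀ : ℝ) ≤ x ^ t₀ := Nat.floor_le (hxpos t₀).le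
  have hT₁ : (T₁ : ℝ) ≤ x ^ t₁ := Nat.floor_le (hxpos t₁).le
  have hLgt : x ^ lam < L := by rw [hLdef]; push_cast; exact Nat.lt_floor_add_one _
  have hMdef : (((T₀ + 1) * (T₁ + 1) : ℕ) : ℝ) = ((T₀ : ℝ) + 1) * ((T₁ : ℝ) + 1) := by
    push_cast; ring
  set M : ℝ := (((T₀ + 1) * (T₁ + 1) : ℕ) : ℝ) with hMset
  have hMle : M ≤ 4 * x ^ (t₀ + t₁) := by
    rw [hMdef, Real.rpow_add hx0]
    have h0 : (T₀ : ℝ) + 1 ≤ 2 * x ^ t₀ := by linarith only [hT₀, hx1t ht₀.le]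
    have h1 : (T₁ : ℝ) + 1 ≤ 2 * x ^ t₁ := by linarith only [hT₁, hx1t ht₁.le]
    calc ((T₀ : ℝ) + 1) * ((T₁ : ℝ) + 1) ≤ (2 * x ^ t₀) * (2 * x ^ t₁) := by gcongr
      _ = 4 * (x ^ t₀ * x ^ t₁) := by ring
  have hMpos : 0 < M := by rw [hMdef]; positivity
  -- the radius
  set R : ℝ := 2 * (1 + c * x ^ s₁) with hRdef
  have hcx : 0 ≤ c * x ^ s₁ := mul_nonneg hc (hxpos s₁).le
  have hR2 : 2 ≤ R := by rw [hRdef]; linarith only [hcx]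
  have hRpos : 0 < R := by linarith only [hR2]
  have hRle : R ≤ (2 + 2 * c) * x ^ s₁ := by
    have := hx1t hs₁.le
    rw [hRdef]; linarith only [this, hcx]
  have hlogR0 : 0 ≤ Real.log R := Real.log_nonneg (by linarith only [hR2])
  have hlogR : Real.log R ≤ Real.log (2 + 2 * c) + s₁ * Real.log x := by
    calc Real.log R ≤ Real.log ((2 + 2 * c) * x ^ s₁) := Real.log_le_log hRpos hRle
      _ = Real.log (2 + 2 * c) + s₁ * Real.log x := by
          rw [Real.log_mul (by positivity) (hxpos _).ne', Real.log_rpow hx0]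
  have h1 : Real.log M ≤ Real.log 4 + (t₀ + t₁) * Real.log x := by
    calc Real.log M ≤ Real.log (4 * x ^ (t₀ + t₁)) := Real.log_le_log hMpos hMle
      _ = Real.log 4 + (t₀ + t₁) * Real.log x := by
          rw [Real.log_mul (by norm_num) (hxpos _).ne', Real.log_rpow hx0]
  have h2 : (T₀ : ℝ) * Real.log R ≤ x ^ t₀ * (Real.log (2 + 2 * c) + s₁ * Real.log x) :=
    mul_le_mul hT₀ hlogR hlogR0 (hxpos _).le
  have h3' : (T₁ : ℝ) * R ≤ (2 + 2 * c) * x ^ (s₁ + t₁) := by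
    calc (T₁ : ℝ) * R ≤ x ^ t₁ * ((2 + 2 * c) * x ^ s₁) :=
          mul_le_mul hT₁ hRle hRpos.le (hxpos _).le
      _ = (2 + 2 * c) * x ^ (s₁ + t₁) := by rw [Real.rpow_add hx0]; ring
  have h4 : -((L : ℝ) * Real.log 2) ≤ -(x ^ lam * Real.log 2) := by
    have := mul_le_mul_of_nonneg_right hLgt.le hl2.le
    linarith only [this]
  have hx : x ^ (1 : ℝ) = x := Real.rpow_one x
  have hx0' : x ^ (0 : ℝ) = 1 := Real.rpow_zero x
  rw [hx] at Ec3
  rw [hx0', mul_one] at Ec2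
  linarith only [h1, h2, h3', h4, Ec1, Ec2, Ec3, Ec4, Ec5, Ec6, Ec7, hx1]

/-- The three bookkeeping facts at integer points `x = N`. [folklore] -/
theorem eventually_aux_paramsD {s₁ t₀ t₁ u : ℝ} (hs₁ : 0 < s₁) (ht₀ : 0 < t₀) (ht₁ : 0 < t₁)
    (h1u : 1 < u) (ht₀u : t₀ < u) (hst : s₁ + t₁ < u) (h3 : u < (1 + t₀ + t₁) / 2)
    {d : ℕ} (hd : 1 ≤ d) {c : ℝ} (hc : 0 ≤ c) :
    ∀ᶠ N : ℕ in atTop,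
      2 * (⌊(N : ℝ) ^ royLambda t₀ t₁ u⌋₊ + 1) ≤
          (⌊(N : ℝ) ^ t₀⌋₊ + 1) * (⌊(N : ℝ) ^ t₁ / d⌋₊ + 1) ∧
      ((⌊(N : ℝ) ^ royLambda t₀ t₁ u⌋₊ + 1 : ℕ) : ℝ) /
          ((((⌊(N : ℝ) ^ t₀⌋₊ + 1) * (⌊(N : ℝ) ^ t₁ / d⌋₊ + 1) : ℕ) : ℝ) -
            ((⌊(N : ℝ) ^ royLambda t₀ t₁ u⌋₊ + 1 : ℕ) : ℝ)) *
        (Real.log (((⌊(N : ℝ) ^ t₀⌋₊ + 1) * (⌊(N : ℝ) ^ t₁ / d⌋₊ + 1) : ℕ) : ℝ) +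
          ((⌊(N : ℝ) ^ royLambda t₀ t₁ u⌋₊ + 1 : ℕ) : ℝ) *
            Real.log ((⌊(N : ℝ) ^ royLambda t₀ t₁ u⌋₊ + 1 : ℕ) : ℝ) +
          (⌊(N : ℝ) ^ t₁⌋₊ : ℝ)) ≤ N ∧
      Real.log 2 - ((⌊(N : ℝ) ^ royLambda t₀ t₁ u⌋₊ + 1 : ℕ) : ℝ) * Real.log 2 +
          Real.log (((⌊(N : ℝ) ^ t₀⌋₊ + 1) * (⌊(N : ℝ) ^ t₁⌋₊ + 1) : ℕ) : ℝ) + N +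
          (⌊(N : ℝ) ^ t₀⌋₊ : ℝ) * Real.log (2 * (1 + c * (N : ℝ) ^ s₁)) +
          (⌊(N : ℝ) ^ t₁⌋₊ : ℝ) * (2 * (1 + c * (N : ℝ) ^ s₁)) ≤ -(2 * (N : ℝ) ^ u) := by
  have H := (eventually_aux_paramsD_count h1u h3 hd).and
    ((eventually_aux_paramsD_siegel hs₁ ht₀ ht₁ h1u hst h3 hd).and
      (eventually_aux_paramsD_small hs₁ ht₀ ht₁ h1u ht₀u hst h3 hc))
  refine (tendsto_natCast_atTop_atTop.eventually H).mono fun N hN => ⟨?_, hN.2.1, hN.2.2⟩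
  exact_mod_cast hN.1


/-! ### The auxiliary polynomial in `ℤ[X₀, X₁^d]` -/

/-- **Auxiliary polynomial in `ℤ[X₀, X₁^d]`.** For `s₁, t₀, t₁ > 0`,
`max{1, t₀, s₁ + t₁} < u < ½(1 + t₀ + t₁)`, `d ≥ 1`, `c ≥ 0` and every large `N` there is a
non-zero `Q_N ∈ ℤ[X₀, X₁^d]` with `deg_{X₀} Q_N ≤ N^{t₀}`, `deg_{X₁} Q_N ≤ N^{t₁}`, height `≤ e^N`,
`Q_N(z, η w) = Q_N(z, w)` for `η^d = 1`, and `|Q_N(z, e^z)| ≤ e^{-2N^u}` for `|z| ≤ 1 + cN^{s₁}` —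
the polynomial `Q_N` of Roy 2001, Prop. 2 (there obtained from Theorem 3 as
`∏_{k<d} P_N(X₀, ζ^k X₁)`), here from Siegel's lemma on the Taylor coefficients of `Q(z, e^z)` at
`0` and the Schwarz lemma. [folklore: Thue–Siegel–Waldschmidt auxiliary function;
cf. Roy2001, Prop. 2 (proof) and Thm. 3] -/
theorem exists_royAuxPolyD {s₁ t₀ t₁ u : ℝ} (hs₁ : 0 < s₁) (ht₀ : 0 < t₀) (ht₁ : 0 < t₁)
    (h1u : 1 < u) (ht₀u : t₀ < u) (hst : s₁ + t₁ < u) (h3 : u < (1 + t₀ + t₁) / 2)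
    {d : ℕ} (hd : 1 ≤ d) {c : ℝ} (hc : 0 ≤ c) :
    ∀ᶠ N : ℕ in atTop, ∃ Q : MvPolynomial (Fin 2) ℤ, Q ≠ 0 ∧
      (Q.degreeOf 0 : ℝ) ≤ (N : ℝ) ^ t₀ ∧ (Q.degreeOf 1 : ℝ) ≤ (N : ℝ) ^ t₁ ∧
      (mvPolyHeight Q : ℝ) ≤ Real.exp N ∧
      (∀ η : ℂ, η ^ d = 1 → ∀ z w : ℂ, aeval ![z, η * w] Q = aeval ![z, w] Q) ∧
      ∀ z : ℂ, ‖z‖ ≤ 1 + c * (N : ℝ) ^ s₁ → ‖expEval Q z‖ ≤ Real.exp (-(2 * (N : ℝ) ^ u)) := by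
  filter_upwards [eventually_aux_paramsD hs₁ ht₀ ht₁ h1u ht₀u hst h3 hd hc, eventually_ge_atTop 1]
    with N hN hN1
  set x : ℝ := (N : ℝ) with hxdef
  set T₀ : ℕ := ⌊x ^ t₀⌋₊ with hT₀def
  set T₁ : ℕ := ⌊x ^ t₁⌋₊ with hT₁def
  set T₁' : ℕ := ⌊x ^ t₁ / d⌋₊ with hT₁'def
  set L : ℕ := ⌊x ^ royLambda t₀ t₁ u⌋₊ + 1 with hLdef
  obtain ⟨hLM, hheight, hsmall⟩ := hN
  have hx1 : (1 : ℝ) ≤ x := by rw [hxdef]; exact_mod_cast hN1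
  have hx0 : 0 < x := one_pos.trans_le hx1
  have hd0 : d ≠ 0 := by omega
  have hdpos : (0 : ℝ) < d := by exact_mod_cast hd
  have hL1 : 1 ≤ L := Nat.succ_le_succ (Nat.zero_le _)
  have hLM' : L < (T₀ + 1) * (T₁' + 1) := by omega
  -- `d T₁' ≤ T₁`
  have hdT_real : (d : ℝ) * T₁' ≤ x ^ t₁ := by
    calc (d : ℝ) * T₁' ≤ d * (x ^ t₁ / d) :=
          mul_le_mul_of_nonneg_left (Nat.floor_le (div_pos (Real.rpow_pos_of_pos hx0 _) hdpos).le)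
            hdpos.le
      _ = x ^ t₁ := mul_div_cancel₀ _ hdpos.ne'
  have hdT : d * T₁' ≤ T₁ := Nat.le_floor (by push_cast; exact hdT_real)
  have hdT' : (d : ℝ) * T₁' ≤ T₁ := by exact_mod_cast hdT
  -- the entrywise sup norm on integer matrices, under which Mathlib states Siegel's lemma
  -- `Int.Matrix.exists_ne_zero_int_vec_norm_le` (a `letI`, local to this proof)
  letI : SeminormedAddCommGroup (Matrix (Fin L) (Fin (T₀ + 1) × Fin (T₁' + 1)) ℤ) :=
    Matrix.seminormedAddCommGroup
  -- Siegel's lemma for the Taylor matrix `A`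
  obtain ⟨t, ht0, hAt, htnorm⟩ := Int.Matrix.exists_ne_zero_int_vec_norm_le
    (Matrix.of fun (n : Fin L) (ij : Fin (T₀ + 1) × Fin (T₁' + 1)) =>
      taylorInt n (monoXY ij.1 (d * ij.2)))
    (by simpa [Fintype.card_prod, Fintype.card_fin] using hLM') (by simp [Fintype.card_fin]; omega)
  simp only [Fintype.card_prod, Fintype.card_fin] at htnorm
  set M : ℝ := (((T₀ + 1) * (T₁' + 1) : ℕ) : ℝ) with hMset
  have hMpos : 0 < M := by rw [hMset]; positivity
  have hM1 : 1 ≤ M := by rw [hMset]; exact_mod_cast Nat.one_le_iff_ne_zero.2 (by positivity)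
  have hLM_real : (L : ℝ) ≤ M := by rw [hMset]; exact_mod_cast hLM'.le
  -- height
  have hnorm : ‖t‖ ≤ Real.exp N := by
    refine htnorm.trans ?_
    have hA : ‖(Matrix.of fun (n : Fin L) (ij : Fin (T₀ + 1) × Fin (T₁' + 1)) =>
        taylorInt n (monoXY ij.1 (d * ij.2)))‖ ≤ (L : ℝ) ^ L * Real.exp ((d : ℝ) * T₁') :=
      (Matrix.norm_le_iff (by positivity)).2 (norm_taylorMatrixD_entry_le d L T₀ T₁' hL1)
    set X : ℝ := M * max 1 ‖(Matrix.of fun (n : Fin L) (ij : Fin (T₀ + 1) × Fin (T₁' + 1)) =>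
      taylorInt n (monoXY ij.1 (d * ij.2)))‖ with hX
    have hX1 : 1 ≤ X := one_le_mul_of_one_le_of_one_le hM1 (le_max_left _ _)
    have hXpos : 0 < X := one_pos.trans_le hX1
    have he0 : 0 ≤ (L : ℝ) / (M - L) := div_nonneg (Nat.cast_nonneg _) (sub_nonneg.2 hLM_real)
    have hbnd : (1 : ℝ) ≤ (L : ℝ) ^ L * Real.exp ((d : ℝ) * T₁') :=
      one_le_mul_of_one_le_of_one_le (one_le_pow₀ (by exact_mod_cast hL1))
        (Real.one_le_exp (by positivity))
    have hlogX : Real.log X ≤ Real.log M + L * Real.log L + T₁ := by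
      have hmax : max 1 ‖(Matrix.of fun (n : Fin L) (ij : Fin (T₀ + 1) × Fin (T₁' + 1)) =>
          taylorInt n (monoXY ij.1 (d * ij.2)))‖ ≤ (L : ℝ) ^ L * Real.exp ((d : ℝ) * T₁') :=
        max_le hbnd hA
      have hlm : Real.log (max 1 ‖(Matrix.of fun (n : Fin L) (ij : Fin (T₀ + 1) × Fin (T₁' + 1)) =>
          taylorInt n (monoXY ij.1 (d * ij.2)))‖) ≤ L * Real.log L + T₁ := by
        calc Real.log (max 1 ‖(Matrix.of fun (n : Fin L) (ij : Fin (T₀ + 1) × Fin (T₁' + 1)) =>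
              taylorInt n (monoXY ij.1 (d * ij.2)))‖)
            ≤ Real.log ((L : ℝ) ^ L * Real.exp ((d : ℝ) * T₁')) :=
              Real.log_le_log (lt_of_lt_of_le one_pos (le_max_left _ _)) hmax
          _ = L * Real.log L + d * T₁' := by
              rw [Real.log_mul (by positivity) (Real.exp_pos _).ne', Real.log_pow, Real.log_exp]
          _ ≤ L * Real.log L + T₁ := by linarith
      rw [hX, Real.log_mul hMpos.ne' (lt_of_lt_of_le one_pos (le_max_left _ _)).ne']
      linarith
    calc X ^ ((L : ℝ) / (M - L)) = Real.exp (Real.log X * ((L : ℝ) / (M - L))) :=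
          Real.rpow_def_of_pos hXpos _
      _ ≤ Real.exp N := by
          refine Real.exp_le_exp.2 ?_
          calc Real.log X * ((L : ℝ) / (M - L)) = (L : ℝ) / (M - L) * Real.log X := mul_comm _ _
            _ ≤ (L : ℝ) / (M - L) * (Real.log M + L * Real.log L + T₁) :=
                mul_le_mul_of_nonneg_left hlogX he0
            _ ≤ N := hheight
  -- the polynomial `Q = Σ t(a,b) X₀^a X₁^{db}`
  set Q : MvPolynomial (Fin 2) ℤ := ∑ ij, C (t ij) * monoXY ij.1 (d * ij.2) with hQdef
  have hdeg0 : Q.degreeOf 0 ≤ T₀ := degreeOf_polyOfCoeffsD_fst d t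
  have hdeg1 : Q.degreeOf 1 ≤ T₁ := (degreeOf_polyOfCoeffsD_snd d t).trans hdT
  have hHt : (mvPolyHeight Q : ℝ) ≤ Real.exp N := (mvPolyHeight_polyOfCoeffsD_le hd0 t).trans hnorm
  have hQ0 : Q ≠ 0 := polyOfCoeffsD_ne_zero hd0 ht0
  have hinv : ∀ η : ℂ, η ^ d = 1 → ∀ z w : ℂ, aeval ![z, η * w] Q = aeval ![z, w] Q :=
    fun η hη z w => aeval_polyOfCoeffsD_mul t z w η hη
  refine ⟨Q, hQ0, ?_, ?_, hHt, hinv, ?_⟩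
  · calc (Q.degreeOf 0 : ℝ) ≤ T₀ := by exact_mod_cast hdeg0
      _ ≤ x ^ t₀ := Nat.floor_le (Real.rpow_nonneg hx0.le _)
  · calc (Q.degreeOf 1 : ℝ) ≤ T₁ := by exact_mod_cast hdeg1
      _ ≤ x ^ t₁ := Nat.floor_le (Real.rpow_nonneg hx0.le _)
  · intro z hz
    set R : ℝ := 2 * (1 + c * x ^ s₁) with hRdef
    have hr0 : 0 ≤ c * x ^ s₁ := mul_nonneg hc (Real.rpow_nonneg hx0.le _)
    have hR1 : 1 ≤ R := by rw [hRdef]; linarith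
    have hRpos : 0 < R := one_pos.trans_le hR1
    have hexpR1 : 1 ≤ Real.exp R := Real.one_le_exp hRpos.le
    -- vanishing of the first L Taylor coefficients
    have hvan : ∀ n < L, iteratedDeriv n (expEval Q) 0 = 0 := by
      intro n hn
      have h1 := congrFun hAt ⟨n, hn⟩
      rw [taylorMatrixD_mulVec] at h1
      simp only [Pi.zero_apply] at h1
      have h1' : taylorInt n Q = 0 := h1
      rw [← taylorInt_cast, h1']
      simp
    -- growth on `|w| = R`
    set M₂ : ℝ := (((T₀ + 1) * (T₁ + 1) : ℕ) : ℝ) with hM₂set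
    have hM₂pos : 0 < M₂ := by rw [hM₂set]; positivity
    have hCR : ∀ w ∈ sphere (0 : ℂ) R, ‖expEval Q w‖ ≤
        M₂ * mvPolyHeight Q * R ^ T₀ * Real.exp R ^ T₁ := by
      intro w hw
      have hwR : ‖w‖ = R := by simpa using hw
      have hew : ‖cexp w‖ ≤ Real.exp R := by
        rw [Complex.norm_exp]
        exact Real.exp_le_exp.2 ((Complex.re_le_norm w).trans hwR.le)
      exact norm_aeval_le_of_degreeOf_le Q hdeg0 hdeg1 w (cexp w) hwR.le hew hR1 hexpR1
    have hzR : ‖z‖ ≤ R / 2 := by rw [hRdef]; linarith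
    have hbound := norm_le_of_iteratedDeriv_eq_zero (differentiable_expEval _) hRpos hvan hCR hzR
    refine hbound.trans ?_
    have eL : ((1 : ℝ) / 2) ^ L = Real.exp (-((L : ℝ) * Real.log 2)) := by
      rw [Real.exp_neg, Real.exp_nat_mul, Real.exp_log two_pos, one_div, inv_pow]
    have eR : R ^ T₀ = Real.exp ((T₀ : ℝ) * Real.log R) := by
      rw [Real.exp_nat_mul, Real.exp_log hRpos]
    have eT : Real.exp R ^ T₁ = Real.exp ((T₁ : ℝ) * R) := by
      rw [← Real.exp_nat_mul]
    calc 2 * ((1 : ℝ) / 2) ^ L * (M₂ * mvPolyHeight Q * R ^ T₀ * Real.exp R ^ T₁)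
        ≤ 2 * ((1 : ℝ) / 2) ^ L * (M₂ * Real.exp N * R ^ T₀ * Real.exp R ^ T₁) := by gcongr
      _ = Real.exp (Real.log 2) * Real.exp (-((L : ℝ) * Real.log 2)) *
            (Real.exp (Real.log M₂) * Real.exp N * Real.exp ((T₀ : ℝ) * Real.log R) *
              Real.exp ((T₁ : ℝ) * R)) := by
          rw [← eL, ← eR, ← eT, Real.exp_log two_pos, Real.exp_log hM₂pos]
      _ = Real.exp (Real.log 2 - L * Real.log 2 + Real.log M₂ + N + T₀ * Real.log R + T₁ * R) := by
          simp only [sub_eq_add_neg, Real.exp_add]; ring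
      _ ≤ Real.exp (-(2 * x ^ u)) := Real.exp_le_exp.2 hsmall

end AuxPolyD


/-! ### Roy 2001, Proposition 2 -/

/-- `k! e^{-2N^u} ≤ e^{-N^u}` for `k ≤ N^{s₀}` and large `N`, because `s₀ < u` (Roy 2001,
p. 191: "Suppose that `N` is large enough so that … `N^{s₀} log(N^{s₀}) ≤ N^u`").
[cite: Roy2001, Prop. 2 (proof)] -/
theorem eventually_factorial_mul_exp_le {s₀ u : ℝ} (hs₀ : 0 < s₀) (hs₀u : s₀ < u) :
    ∀ᶠ N : ℕ in atTop, ∀ k : ℕ, (k : ℝ) ≤ (N : ℝ) ^ s₀ →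
      (k.factorial : ℝ) * Real.exp (-(2 * (N : ℝ) ^ u)) ≤ Real.exp (-(N : ℝ) ^ u) := by
  have H : ∀ᶠ x : ℝ in atTop, ∀ k : ℕ, (k : ℝ) ≤ x ^ s₀ →
      (k.factorial : ℝ) * Real.exp (-(2 * x ^ u)) ≤ Real.exp (-x ^ u) := by
    filter_upwards [eventually_ge_atTop (1 : ℝ),
      eventually_mul_rpow_mul_log_le hs₀u hs₀.le one_pos] with x hx1 E9
    have hx0 : 0 < x := one_pos.trans_le hx1
    intro k hk
    have hb1 : 1 ≤ x ^ s₀ := Real.one_le_rpow hx1 hs₀.le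
    have hkk : (k.factorial : ℝ) ≤ Real.exp (x ^ u) := by
      calc (k.factorial : ℝ) ≤ (k : ℝ) ^ k := by exact_mod_cast Nat.factorial_le_pow k
        _ ≤ (x ^ s₀) ^ k := by gcongr
        _ = (x ^ s₀) ^ (k : ℝ) := (Real.rpow_natCast _ k).symm
        _ ≤ (x ^ s₀) ^ (x ^ s₀) := Real.rpow_le_rpow_of_exponent_le hb1 hk
        _ = Real.exp (s₀ * x ^ s₀ * Real.log x) := by
            rw [Real.rpow_def_of_pos (Real.rpow_pos_of_pos hx0 s₀), Real.log_rpow hx0]; ring_nf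
        _ ≤ Real.exp (x ^ u) := by
            rw [Real.exp_le_exp]; simpa using E9
    calc (k.factorial : ℝ) * Real.exp (-(2 * x ^ u))
        ≤ Real.exp (x ^ u) * Real.exp (-(2 * x ^ u)) := by gcongr
      _ = Real.exp (-x ^ u) := by rw [← Real.exp_add]; ring_nf
  exact tendsto_natCast_atTop_atTop.eventually H

/-- DISCHARGE of `Roy2001_prop2` — **Roy 2001, Proposition 2** (p. 191): for
`(y, α) ∈ ℂ × ℂˣ` and positive `s₀, s₁, t₀, t₁, u` with
`max{1, s₀, t₀, s₁ + t₁} < u < ½(1 + t₀ + t₁)`, if `α e^{-y}` is a root of unity then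
condition (b) of Theorem 1 holds for `(y, α)`. Proof as in print — `α = ζ e^y`, `ζ^d = 1`,
`g_N(z) = Q_N(z, e^z) = Q_N(z, ζ^m e^z)`, `d^k g_N/dz^k (my) = (D^k Q_N)(my, α^m)`, Cauchy's
inequalities on `|z - my| = 1`, `k! ≤ e^{N^u}` — with the polynomial `Q_N ∈ ℤ[X₀, X₁^d]` supplied by
`exists_royAuxPolyD` instead of Theorem 3. [cite: Roy2001, Prop. 2] -/
theorem Roy2001_prop2_holds : Roy2001_prop2 := by
  intro y α _hα s₀ s₁ t₀ t₁ u hs₀ hs₁ ht₀ ht₁ _hu h1 h2 ha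
  have h1' := max_lt_iff.1 h1
  have h1'' := max_lt_iff.1 h1'.2
  have h1''' := max_lt_iff.1 h1''.2
  -- `α = ζ e^y` with `ζ^d = 1`
  obtain ⟨d, hd1, hζ⟩ := (royCondA_iff y α).1 ha
  set ζ : ℂ := α * cexp (-y) with hζdef
  have hαζ : α = ζ * cexp y := by
    rw [hζdef, mul_assoc, ← Complex.exp_add, neg_add_cancel, Complex.exp_zero, mul_one]
  set c : ℝ := ‖y‖ with hcdef
  have hc : 0 ≤ c := norm_nonneg _
  filter_upwards [exists_royAuxPolyD hs₁ ht₀ ht₁ h1'.1 h1'''.1 h1'''.2 h2 hd1 hc,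
    eventually_factorial_mul_exp_le hs₀ h1''.1] with N hN hfact
  obtain ⟨Q, hQ0, hdeg0, hdeg1, hH, hinv, hval⟩ := hN
  refine ⟨Q, hQ0, hdeg0, hdeg1, hH, fun k m hk hm => ?_⟩
  -- `F(s) = Q(my + s, α^m e^s) = g(my + s)` with `g(z) = Q(z, e^z)`
  set F : ℂ → ℂ := fun s => aeval ![(m : ℂ) * y + s, α ^ m * cexp s] Q with hFdef
  have hη : (ζ ^ m) ^ d = 1 := by rw [← pow_mul, mul_comm, pow_mul, hζ, one_pow]
  have hFeq : ∀ s, F s = expEval Q ((m : ℂ) * y + s) := by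
    intro s
    have hpt : α ^ m * cexp s = ζ ^ m * cexp ((m : ℂ) * y + s) := by
      rw [hαζ, mul_pow, ← Complex.exp_nat_mul, Complex.exp_add]; ring
    simp only [hFdef, expEval_apply, hpt]
    exact hinv (ζ ^ m) hη _ _
  have hderiv : aeval ![(m : ℂ) * y, α ^ m] (royD^[k] Q) = iteratedDeriv k F 0 := by
    rw [hFdef, iteratedDeriv_aeval_add_mul_exp]
    simp
  have hFdiff : Differentiable ℂ F := fun s =>
    (hasDerivAt_aeval_add_mul_exp Q ((m : ℂ) * y) (α ^ m) s).differentiableAt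
  have hsphere : ∀ s ∈ sphere (0 : ℂ) 1, ‖F s‖ ≤ Real.exp (-(2 * (N : ℝ) ^ u)) := by
    intro s hs
    rw [hFeq]
    refine hval _ ?_
    have hs1 : ‖s‖ = 1 := by simpa using hs
    calc ‖(m : ℂ) * y + s‖ ≤ ‖(m : ℂ) * y‖ + ‖s‖ := norm_add_le _ _
      _ = m * c + 1 := by rw [norm_mul, Complex.norm_natCast, hs1]
      _ ≤ (N : ℝ) ^ s₁ * c + 1 := by gcongr
      _ = 1 + c * (N : ℝ) ^ s₁ := by ring
  have hC := Complex.norm_iteratedDeriv_le_of_forall_mem_sphere_norm_le (f := F) k one_pos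
    hFdiff.diffContOnCl hsphere
  rw [hderiv]
  calc ‖iteratedDeriv k F 0‖ ≤ k.factorial * Real.exp (-(2 * (N : ℝ) ^ u)) / 1 ^ k := hC
    _ = k.factorial * Real.exp (-(2 * (N : ℝ) ^ u)) := by rw [one_pow, div_one]
    _ ≤ Real.exp (-(N : ℝ) ^ u) := hfact k hk

/-! ### Roy 2001, Theorem 1 -/

/-- DISCHARGE of `Roy2001_thm1` — **Roy 2001, Theorem 1** (p. 184): for `(y, α) ∈ ℂ × ℂˣ` and
positive parameters in the window (1), conditions (a) (`∃ d ≥ 1, α^d = e^{dy}`) and (b) are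
equivalent. Assembled from Proposition 2 (`Roy2001_prop2_holds`) and Proposition 3
(`Roy2001_prop3_holds`) by `Roy2001_thm1_of` (Roy 2001, §4, p. 190: "We divide the proof of
Theorem 1 into two propositions"). [cite: Roy2001, Thm. 1] -/
theorem Roy2001_thm1_holds : Roy2001_thm1 :=
  Roy2001_thm1_of Roy2001_prop2_holds Roy2001_prop3_holds

end Literature.NumberTheory.Transcendental

end
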